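import Summits.Parity.GeneralizedHardyLittlewood.Theorems.LeeYangFibresRelativeDimOneSplitDefs
import Summits.Parity.GeneralizedHardyLittlewood.Theorems.LeeYangFibresRelativeDimOneLocalAverage
import HarnessLib

/-!
# The local identity `#{r mod q : gcd(a_i r + c_i, q) = 1 ∀ i} · q^{t-1} = φ(q)^t ∏_{p ∣ q} β_p(a, c)`
(crux stmt-Parity-14113 `LeeYangFibres.RelativeDimOne`, line gallagher-backwards-split, stub
`stub_inversion`, PIECE 3a)

This is the identity matching the main term of `MovingClassMoments` (prime side of the
dictionary) with the main term of `CosetSingularMean` (singular-series side): writing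
`G(q) = #{r < q : ∀ i, gcd(a_i r + c_i, q) = 1}`,

  `G(q) · q^t = q · φ(q)^t · localTypeFactor q a c`        (`card_coprime_classes_eq`).

Proof: both sides are "multiplicative in `q`" and agree on prime powers.
* `G(m n) = G(m) G(n)` for coprime `m, n` (`card_coprime_classes_mul`): `gcd(x, m n) = 1` iff
  `gcd(x, m) = 1 ∧ gcd(x, n) = 1`, the conditions depend on `r mod m`, `r mod n` only, and
  `r ↦ (r mod m, r mod n)` is the Chinese-remainder bijection (`card_filter_range_mul_coprime`).
* `G(p^k) = p^{k-1} G(p)` (`card_coprime_classes_prime_pow`): the condition depends on `r mod p`.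
* `G(p) · p^t = p · (p − 1)^t · β_p` (`card_coprime_classes_prime`): at a prime,
  `β_p = p⁻¹ Σ_{r<p} ∏_i Λ_p(a_i r + c_i) = p⁻¹ (p/(p-1))^t G(p)` (`localFactor_fin_one`).
* Assemble along `Nat.recOnPosPrimePosCoprime` with `φ(p^k) = p^{k-1}(p-1)`, `φ(mn) = φ(m)φ(n)` and
  `primeFactors (m n) = primeFactors m ⊔ primeFactors n`.
-/

noncomputable section

open scoped BigOperators Classical Topology
open Finset Filter MeasureTheory Literature.NumberTheory.Sieve
open Summit.Parity.GeneralizedHardyLittlewood.Cruxes.RelativeDimOne.TranslateAmplification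
  (localFactor_fin_one)

namespace Summit.Parity.GeneralizedHardyLittlewood.Cruxes.RelativeDimOne.GallagherBackwardsSplit

variable {t : ℕ}

/-! ### Counting lemmas on `range` -/

/-- Chinese remainder counting: for coprime `m, n ≥ 1` and predicates read modulo `m` and `n`,
`#{r < m n : P(r mod m) ∧ Q(r mod n)} = #{u < m : P u} · #{v < n : Q v}`. -/
theorem card_filter_range_mul_coprime {m n : ℕ} (hm : 0 < m) (hn : 0 < n) (co : m.Coprime n)
    (P Q : ℕ → Prop) [DecidablePred P] [DecidablePred Q] :
    ((range (m * n)).filter (fun r => P (r % m) ∧ Q (r % n))).card =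
      ((range m).filter P).card * ((range n).filter Q).card := by
  rw [← Finset.card_product]
  refine Finset.card_nbij' (fun r => (r % m, r % n)) (fun uv => (Nat.chineseRemainder co uv.1 uv.2 : ℕ))
    ?_ ?_ ?_ ?_
  · intro r hr
    rw [Finset.mem_coe, Finset.mem_filter] at hr
    rw [Finset.mem_coe, Finset.mem_product, Finset.mem_filter, Finset.mem_filter]
    exact ⟨⟨Finset.mem_range.2 (Nat.mod_lt _ hm), hr.2.1⟩, ⟨Finset.mem_range.2 (Nat.mod_lt _ hn), hr.2.2⟩⟩
  · intro uv huv
    rw [Finset.mem_coe, Finset.mem_product, Finset.mem_filter, Finset.mem_filter] at huv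
    rw [Finset.mem_coe, Finset.mem_filter]
    have hu : uv.1 < m := Finset.mem_range.1 huv.1.1
    have hv : uv.2 < n := Finset.mem_range.1 huv.2.1
    set z := Nat.chineseRemainder co uv.1 uv.2 with hz
    have h1 : (z : ℕ) % m = uv.1 := by
      have := z.prop.1
      rw [Nat.ModEq] at this
      rw [this, Nat.mod_eq_of_lt hu]
    have h2 : (z : ℕ) % n = uv.2 := by
      have := z.prop.2
      rw [Nat.ModEq] at this
      rw [this, Nat.mod_eq_of_lt hv]
    refine ⟨Finset.mem_range.2 (Nat.chineseRemainder_lt_mul co _ _ hm.ne' hn.ne'), ?_, ?_⟩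
    · rw [h1]; exact huv.1.2
    · rw [h2]; exact huv.2.2
  · intro r hr
    rw [Finset.mem_coe, Finset.mem_filter] at hr
    have hr' : r < m * n := Finset.mem_range.1 hr.1
    have hmod : r ≡ (Nat.chineseRemainder co (r % m) (r % n) : ℕ) [MOD m * n] :=
      Nat.chineseRemainder_modEq_unique co (Nat.mod_modEq r m).symm (Nat.mod_modEq r n).symm
    exact (Nat.ModEq.eq_of_lt_of_lt hmod hr'
      (Nat.chineseRemainder_lt_mul co _ _ hm.ne' hn.ne')).symm
  · intro uv huv
    rw [Finset.mem_coe, Finset.mem_product, Finset.mem_filter, Finset.mem_filter] at huv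
    have hu : uv.1 < m := Finset.mem_range.1 huv.1.1
    have hv : uv.2 < n := Finset.mem_range.1 huv.2.1
    set z := Nat.chineseRemainder co uv.1 uv.2 with hz
    have h1 : (z : ℕ) % m = uv.1 := by
      have := z.prop.1
      rw [Nat.ModEq] at this
      rw [this, Nat.mod_eq_of_lt hu]
    have h2 : (z : ℕ) % n = uv.2 := by
      have := z.prop.2
      rw [Nat.ModEq] at this
      rw [this, Nat.mod_eq_of_lt hv]
    exact Prod.ext h1 h2

/-- Periodic counting: `#{r < p s : P(r mod p)} = s · #{u < p : P u}` (`p ≥ 1`). -/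
theorem card_filter_range_mul_periodic {p : ℕ} (hp : 0 < p) (s : ℕ) (P : ℕ → Prop) [DecidablePred P] :
    ((range (p * s)).filter (fun r => P (r % p))).card = s * ((range p).filter P).card := by
  induction s with
  | zero => simp
  | succ s ih =>
    have hsplit : range (p * (s + 1)) = range (p * s) ∪ (range p).image (fun u => p * s + u) := by
      ext r
      simp only [mem_union, mem_range, mem_image]
      constructor
      · intro hr
        by_cases h : r < p * s
        · exact Or.inl h
        · refine Or.inr ⟨r - p * s, ?_, ?_⟩
          · rw [mul_add, mul_one] at hr; omega
          · omega
      · rintro (h | ⟨u, hu, rfl⟩)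
        · rw [mul_add, mul_one]; omega
        · rw [mul_add, mul_one]; omega
    have hdisj : Disjoint ((range (p * s)).filter (fun r => P (r % p)))
        (((range p).image (fun u => p * s + u)).filter (fun r => P (r % p))) := by
      rw [Finset.disjoint_left]
      intro r hr hr'
      rw [mem_filter, mem_range] at hr
      rw [mem_filter, mem_image] at hr'
      obtain ⟨⟨u, -, hu⟩, -⟩ := hr'
      omega
    rw [hsplit, filter_union, card_union_of_disjoint hdisj, ih, add_mul, one_mul]
    congr 1
    rw [Finset.filter_image, Finset.card_image_of_injective _ (fun u v h => by simpa using h)]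
    congr 1
    refine Finset.filter_congr fun u hu => ?_
    rw [mem_range] at hu
    simp [Nat.mod_eq_of_lt hu]

/-! ### The coprimality count -/

/-- `gcd(a r + c, q)` only depends on `r mod n` whenever `q ∣ n`:
`gcd(a r + c, q) = gcd(a (r mod n) + c, q)`. -/
theorem int_gcd_linear_mod {q n : ℕ} (hqn : q ∣ n) (a c : ℤ) (r : ℕ) :
    Int.gcd (a * r + c) q = Int.gcd (a * ((r % n : ℕ) : ℤ) + c) q := by
  have h : a * r + c ≡ a * ((r % n : ℕ) : ℤ) + c [ZMOD q] := by
    have h1 : (r : ℤ) ≡ ((r % n : ℕ) : ℤ) [ZMOD n] := by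
      rw [Int.natCast_mod]
      exact (Int.mod_modEq _ _).symm
    exact ((h1.of_dvd (Int.natCast_dvd_natCast.2 hqn)).mul_left a).add_right c
  rw [← Int.gcd_emod, h.eq, Int.gcd_emod]

/-- `gcd(x, m n) = 1 ↔ gcd(x, m) = 1 ∧ gcd(x, n) = 1`. -/
theorem int_gcd_mul_eq_one_iff (x : ℤ) (m n : ℕ) :
    Int.gcd x (m * n : ℕ) = 1 ↔ Int.gcd x m = 1 ∧ Int.gcd x n = 1 := by
  rw [← Int.isCoprime_iff_gcd_eq_one, ← Int.isCoprime_iff_gcd_eq_one,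
    ← Int.isCoprime_iff_gcd_eq_one, Nat.cast_mul, IsCoprime.mul_right_iff]

/-- `gcd(x, p^k) = 1 ↔ gcd(x, p) = 1` for `k ≥ 1`. -/
theorem int_gcd_pow_eq_one_iff (x : ℤ) (p : ℕ) {k : ℕ} (hk : 0 < k) :
    Int.gcd x (p ^ k : ℕ) = 1 ↔ Int.gcd x p = 1 := by
  rw [← Int.isCoprime_iff_gcd_eq_one, ← Int.isCoprime_iff_gcd_eq_one, Nat.cast_pow,
    IsCoprime.pow_right_iff hk]

/-- CRT multiplicativity of the coprimality count. -/
theorem card_coprime_classes_mul {m n : ℕ} (hm : 0 < m) (hn : 0 < n) (co : m.Coprime n)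
    (a c : Fin t → ℤ) :
    ((range (m * n)).filter (fun r : ℕ => ∀ i, Int.gcd (a i * r + c i) (m * n : ℕ) = 1)).card =
      ((range m).filter (fun r : ℕ => ∀ i, Int.gcd (a i * r + c i) m = 1)).card *
        ((range n).filter (fun r : ℕ => ∀ i, Int.gcd (a i * r + c i) n = 1)).card := by
  rw [← card_filter_range_mul_coprime hm hn co]
  congr 1
  refine Finset.filter_congr fun r _ => ?_
  constructor
  · intro h
    refine ⟨fun i => ?_, fun i => ?_⟩
    · rw [← int_gcd_linear_mod (dvd_refl m)]
      exact ((int_gcd_mul_eq_one_iff _ m n).1 (h i)).1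
    · rw [← int_gcd_linear_mod (dvd_refl n)]
      exact ((int_gcd_mul_eq_one_iff _ m n).1 (h i)).2
  · rintro ⟨h1, h2⟩ i
    rw [int_gcd_mul_eq_one_iff]
    exact ⟨by rw [int_gcd_linear_mod (dvd_refl m)]; exact h1 i,
      by rw [int_gcd_linear_mod (dvd_refl n)]; exact h2 i⟩

/-- The count at a prime power: `G(p^k) = p^{k-1} G(p)`. -/
theorem card_coprime_classes_prime_pow {p : ℕ} (hp : 0 < p) {k : ℕ} (hk : 0 < k)
    (a c : Fin t → ℤ) :
    ((range (p ^ k)).filter (fun r : ℕ => ∀ i, Int.gcd (a i * r + c i) (p ^ k : ℕ) = 1)).card =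
      p ^ (k - 1) * ((range p).filter (fun r : ℕ => ∀ i, Int.gcd (a i * r + c i) p = 1)).card := by
  rw [← card_filter_range_mul_periodic hp]
  have hpk : p ^ k = p * p ^ (k - 1) := by
    rw [← pow_succ']
    congr 1
    omega
  rw [← hpk]
  congr 1
  refine Finset.filter_congr fun r _ => ?_
  refine forall_congr' fun i => ?_
  rw [int_gcd_pow_eq_one_iff _ _ hk, int_gcd_linear_mod (dvd_refl p)]

/-- The count at a prime: `G(p) · p^t = p · (p − 1)^t · β_p(a, c)`. -/
theorem card_coprime_classes_prime {p : ℕ} (hp : p.Prime) (a c : Fin t → ℤ) :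
    ((((range p).filter (fun r : ℕ => ∀ i, Int.gcd (a i * r + c i) p = 1)).card : ℕ) : ℝ) *
        (p : ℝ) ^ t =
      (p : ℝ) * ((p : ℝ) - 1) ^ t * localFactor (sys a c) p := by
  have hp0 : (0 : ℝ) < p := by exact_mod_cast hp.pos
  have hp1 : (0 : ℝ) < (p : ℝ) - 1 := by
    have : (2 : ℝ) ≤ p := by exact_mod_cast hp.two_le
    linarith
  have htot : (Nat.totient p : ℝ) = (p : ℝ) - 1 := by
    rw [Nat.totient_prime hp, Nat.cast_sub hp.pos, Nat.cast_one]
  have hβ : localFactor (sys a c) p =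
      (p : ℝ)⁻¹ * (((p : ℝ) / ((p : ℝ) - 1)) ^ t *
        ((((range p).filter (fun r : ℕ => ∀ i, Int.gcd (a i * r + c i) p = 1)).card : ℕ) : ℝ)) := by
    rw [localFactor_fin_one]
    congr 1
    have hterm : ∀ r ∈ range p,
        (∏ i, localVonMangoldt p ((sys a c i).eval fun _ => (r : ℤ))) =
          if (∀ i, Int.gcd (a i * r + c i) p = 1) then ((p : ℝ) / ((p : ℝ) - 1)) ^ t else 0 := by
      intro r _
      have heval : ∀ i, (sys a c i).eval (fun _ => (r : ℤ)) = a i * r + c i := by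
        intro i
        simp [sys, AffLinForm.eval]
      simp_rw [heval, localVonMangoldt, htot]
      rw [Finset.prod_ite_zero, Finset.prod_const, Finset.card_univ, Fintype.card_fin]
      simp
    rw [Finset.sum_congr rfl hterm, Finset.sum_ite, Finset.sum_const_zero, add_zero,
      Finset.sum_const, nsmul_eq_mul, mul_comm]
  rw [hβ, div_pow]
  field_simp

/-- THE LOCAL IDENTITY: `#{r < q : ∀ i, gcd(a_i r + c_i, q) = 1} · q^t = q · φ(q)^t · ∏_{p ∣ q} β_p(a, c)`
(all `q`, all `t`; for `q ≥ 1`, `t ≥ 1` this is `#{…} · q^{t−1} = φ(q)^t · localTypeFactor q a c`). -/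
theorem card_coprime_classes_eq : ∀ {t : ℕ} (q : ℕ) (a c : Fin t → ℤ), ((((Finset.range q).filter (fun r : ℕ => ∀ i, Int.gcd (a i * r + c i) q = 1)).card : ℕ) : ℝ) * (q : ℝ) ^ t = (q : ℝ) * (Nat.totient q : ℝ) ^ t * localTypeFactor q a c := by
  intro t q a c
  induction q using Nat.recOnPosPrimePosCoprime with
  | zero => simp
  | one =>
    have h1 : ((Finset.range 1).filter (fun r : ℕ => ∀ i, Int.gcd (a i * r + c i) ((1 : ℕ) : ℤ) = 1)) =
        Finset.range 1 := by
      refine Finset.filter_true_of_mem fun r _ i => ?_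
      simp
    rw [h1]
    simp [localTypeFactor]
  | prime_pow p k hp hk =>
    have hp0 : (0 : ℝ) < p := by exact_mod_cast hp.pos
    rw [card_coprime_classes_prime_pow hp.pos hk a c, localTypeFactor,
      Nat.primeFactors_prime_pow hk.ne' hp, Finset.prod_singleton, Nat.totient_prime_pow hp hk]
    have hbase := card_coprime_classes_prime hp a c
    obtain ⟨K, rfl⟩ : ∃ K, k = K + 1 := ⟨k - 1, by omega⟩
    simp only [Nat.add_sub_cancel]
    have hcast : ((p - 1 : ℕ) : ℝ) = (p : ℝ) - 1 := by
      rw [Nat.cast_sub hp.pos, Nat.cast_one]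
    simp only [Nat.cast_mul, Nat.cast_pow, hcast]
    calc (p : ℝ) ^ K *
          ((((range p).filter (fun r : ℕ => ∀ i, Int.gcd (a i * r + c i) p = 1)).card : ℕ) : ℝ) *
          ((p : ℝ) ^ (K + 1)) ^ t
        = (p : ℝ) ^ K * ((p : ℝ) ^ K) ^ t *
            (((((range p).filter (fun r : ℕ => ∀ i, Int.gcd (a i * r + c i) p = 1)).card : ℕ) : ℝ) *
              (p : ℝ) ^ t) := by ring
      _ = (p : ℝ) ^ K * ((p : ℝ) ^ K) ^ t * ((p : ℝ) * ((p : ℝ) - 1) ^ t * localFactor (sys a c) p) := by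
          rw [hbase]
      _ = (p : ℝ) ^ (K + 1) * ((p : ℝ) ^ K * ((p : ℝ) - 1)) ^ t * localFactor (sys a c) p := by
          rw [mul_pow]; ring
  | coprime m n hm hn co ihm ihn =>
    have hm0 : 0 < m := by omega
    have hn0 : 0 < n := by omega
    rw [card_coprime_classes_mul hm0 hn0 co a c, localTypeFactor, Nat.Coprime.primeFactors_mul co,
      Finset.prod_union (Nat.Coprime.disjoint_primeFactors co), Nat.totient_mul co]
    rw [localTypeFactor] at ihm ihn
    simp only [Nat.cast_mul]
    calc ((((range m).filter (fun r : ℕ => ∀ i, Int.gcd (a i * r + c i) m = 1)).card : ℕ) : ℝ) *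
          ((((range n).filter (fun r : ℕ => ∀ i, Int.gcd (a i * r + c i) n = 1)).card : ℕ) : ℝ) *
          ((m : ℝ) * n) ^ t
        = (((((range m).filter (fun r : ℕ => ∀ i, Int.gcd (a i * r + c i) m = 1)).card : ℕ) : ℝ) *
            (m : ℝ) ^ t) *
          (((((range n).filter (fun r : ℕ => ∀ i, Int.gcd (a i * r + c i) n = 1)).card : ℕ) : ℝ) *
            (n : ℝ) ^ t) := by ring
      _ = ((m : ℝ) * (Nat.totient m : ℝ) ^ t * ∏ p ∈ m.primeFactors, localFactor (sys a c) p) *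
          ((n : ℝ) * (Nat.totient n : ℝ) ^ t * ∏ p ∈ n.primeFactors, localFactor (sys a c) p) := by
          rw [ihm, ihn]
      _ = (m : ℝ) * n * ((Nat.totient m : ℝ) * Nat.totient n) ^ t *
          ((∏ p ∈ m.primeFactors, localFactor (sys a c) p) *
            ∏ p ∈ n.primeFactors, localFactor (sys a c) p) := by ring

/-- Corollary in the normalisation of the line (`q ≥ 1`, `t ≥ 1`):
`#{r < q : ∀ i, gcd(a_i r + c_i, q) = 1} / φ(q)^t = q · localTypeFactor q a c / q^t`. -/
theorem card_coprime_classes_div {q : ℕ} (hq : 0 < q) (a c : Fin t → ℤ) :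
    ((((Finset.range q).filter (fun r : ℕ => ∀ i, Int.gcd (a i * r + c i) q = 1)).card : ℕ) : ℝ) /
        (Nat.totient q : ℝ) ^ t =
      (q : ℝ) * localTypeFactor q a c / (q : ℝ) ^ t := by
  have hq0 : (0 : ℝ) < q := by exact_mod_cast hq
  have hφ : (0 : ℝ) < Nat.totient q := by exact_mod_cast Nat.totient_pos.2 hq
  have h := card_coprime_classes_eq q a c
  rw [div_eq_div_iff (pow_ne_zero _ hφ.ne') (pow_ne_zero _ hq0.ne')]
  linarith [h]

end Summit.Parity.GeneralizedHardyLittlewood.Cruxes.RelativeDimOne.GallagherBackwardsSplit
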